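import Mathlib
import Literature.NumberTheory.IwasawaTheory.Greenberg2006.TwistDeformationLEO
import Literature.NumberTheory.GaloisRepresentations.ProfiniteIntersectionTorsionCoefficients
import Literature.NumberTheory.EllipticCurves.IwasawaCyclotomicProofs
import Literature.NumberTheory.IwasawaTheory.PruferPontryaginDual
import HarnessLib

/-!
# WeakLeopoldtCyclotomic

Topic `Literature/NumberTheory/IwasawaTheory`. Named literature fact(s) relocated by the gate from `Summits/BirchSwinnertonDyer/BirchSwinnertonDyer/Theorems/EisensteinPrimesGoodLatticeBDPValueT4OfCyclotomic.lean`
(accept-time relocation of `[cite]`d propositions written inline in a Summits proposal; human ruling 2026-08-15).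
Sources: Greenberg2006, NeukirchSchmidtWingberg2008, NguyenQuangDo1984.

* `Literature.NumberTheory.IwasawaTheory.weakLeopoldt_H2_subsingleton_cyclotomic_of_isOpen`
-/

namespace Literature.NumberTheory.IwasawaTheory

open scoped Classical
open NumberField IsDedekindDomain Field
open Literature.NumberTheory.GaloisRepresentations
open Literature.NumberTheory.EllipticCurves (ZpExtension)
open Literature.NumberTheory.IwasawaTheory Literature.NumberTheory.IwasawaTheory.Greenberg2006

/-- **Weak Leopoldt for the cyclotomic `ℤ_p`-extension, for every finite extension `K′ ⊆ K_Σ` of `K`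
presented by an open subgroup `U₀ ⊇ N_S` of `Γ_K` — `H²(K_Σ/K′K^{cyc}_∞, ℚ_p/ℤ_p) = 0`; named fact**
(Iwasawa's THEOREM: NSW (10.3.25) "the weak Leopoldt [property] is true for the cyclotomic
`ℤ_p`-extension", with (10.3.22) `⟺ H²(G_S(k_∞), ℚ_p/ℤ_p) = 0`, at `k := K′ = K̄^{U₀}`, whose cyclotomic
`ℤ_p`-extension is `K′K^{cyc}_∞`; = [NQD84] Thm. 2.2 / [Gr4] pp. 343–344 at `K_∞ = k_∞^{cyc}` itself;
= the tree's (T4) `weakLeopoldt_H2_subsingleton_above_cyclotomic_of_isOpen` at `m = 1`, `κ₁ = κ`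
cyclotomic — `cyclotomic_of_above_cyclotomic` below, and conversely (T4) follows from it,
`above_cyclotomic_of_cyclotomic`). STANDING: `K` a number
field, `p` an ODD prime, `S ⊇ {v ∣ p}` finite, `κ : ZpExtension K p` CYCLOTOMIC (`κ.IsCyclotomic`:
`ker κ = χ_p⁻¹(μ(ℤ_p))`, `K̄^{ker κ} = K^{cyc}_∞`). TYPED: `U₀ : Subgroup Γ_K` OPEN with `N_S ≤ U₀`
(`K′ := K̄^{U₀} ⊆ K_Σ`); coefficients: ANY commutative topological ring `R` (INERT) and any discrete
`R`-module `D ≃+ ℚ_p/ℤ_p` with the trivial continuous action (dictionary of (T4), module docstring of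
`GaloisCohomologyStructure.lean` §5); CONCLUSION: the continuous `H²` of the closed subgroup
`galoisGroupAbove S (U₀ ⊓ ker κ) = Gal(K_Σ/K′K^{cyc}_∞) ≤ G_{K,S}` with these coefficients is a
subsingleton. PUBLISHED (refereed / textbook); `p = 2` excluded as in (T4).
[cite: NeukirchSchmidtWingberg2008, (10.3.25) with (10.3.22)]
[cite: NguyenQuangDo1984, Déf. 2.1, Thm. 2.2 (LNM 1068 pp. 167–185)]
[cite: Greenberg2006, pp. 343–344 (Hypothesis L p. 342; p. 344 "proved in [NQD]")]
[file NumberTheory/IwasawaTheory/WeakLeopoldtCyclotomic] -/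
def weakLeopoldt_H2_subsingleton_cyclotomic_of_isOpen : Prop :=
  ∀ (K : Type) [Field K] [NumberField K] (p : ℕ) [Fact p.Prime], p ≠ 2 →
  ∀ (S : Set (HeightOneSpectrum (𝓞 K))), S.Finite →
    (∀ v : HeightOneSpectrum (𝓞 K), ((p : ℕ) : 𝓞 K) ∈ v.asIdeal → v ∈ S) →
  ∀ (κ : ZpExtension K p), κ.IsCyclotomic →
  ∀ (U₀ : Subgroup (absoluteGaloisGroup K)),
    IsOpen (U₀ : Set (absoluteGaloisGroup K)) → ramificationSubgroup K S ≤ U₀ →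
  ∀ (R : Type) [CommRing R] [TopologicalSpace R] [IsTopologicalRing R]
    (D : Type) [AddCommGroup D] [Module R D] [TopologicalSpace D] [DiscreteTopology D]
    [ContinuousSMul R D],
    Nonempty (D ≃+ ℚ_[p] ⧸ (PadicInt.subring p).toAddSubgroup) →
    Subsingleton ((ContinuousRep.trivial (galoisGroupAbove S (U₀ ⊓ κ.kerSubgroup)) R D).H 2)

end Literature.NumberTheory.IwasawaTheory
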